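import Summits.HubbardSuperconductivity.HubbardLadder.PairCorrSectorCert
import Summits.HubbardSuperconductivity.HubbardLadder.HubbardDopedMomentRows
import Literature.MathematicalPhysics.QuantumLattice.RayleighBottom
import HarnessLib

/-!
# R2 rows (device D27), part 1 of 2: the `S^z`-resolution glue and the generic `4 × 4`, `U = 8`, `N = 14`,
# `t' = 0` sector-certificate edges

HONEST FRAMING (page 1): ladder R1–R4 with certified numbers; no claim on H/H₀.

This module is §1–§2 of the D27 file `HubbardDopedAFWindowRows.lean` (split in two by the filer only because the
gate caps `Summits/` files at 400 lines; every declaration is byte-identical to the staged single file,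
sha256 `2c4d8a1bb11606f5…`; the full module docstring, the two `secrows1` claim nodes and the numeric rows are in
part 2, `Summits.HubbardSuperconductivity.HubbardLadder.HubbardDopedAFWindowRows`, which imports this file).

§1 THE GLUE (generic over a finite ordered lattice `Λ`, PROVED): a sector-mode certificate bounds `Re ⟨φ, X φ⟩`
only for joint `(N, S^z)`-eigen eigenvectors `φ` (`TorusSectorObsCertTT'.re_expect_ge_of_eigenvector`). If `H`
and `X` both preserve the `(N↑, N↓)` sectors (`PreservesSectors`; true for the Hubbard Hamiltonian and for every
`𝐒_x·𝐒_y`, hence for `𝓢 = stagStructureFour` and for `Σ_x n_{x↑} n_{x↓}`), then for an `N`-particle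
`H`-eigenvector `ψ` with eigenvalue `E` the sector components `ψ_a = sectorProj a (N − a) ψ` are `H`-eigenvectors
with the same `E` lying in `szSector N ((2a − N)/2)`, `⟨ψ, X ψ⟩ = Σ_a ⟨ψ_a, X ψ_a⟩` and `Σ_a ‖ψ_a‖² = ‖ψ‖²`; so a
bound `q ≤ Re ⟨φ, X φ⟩` valid for every unit joint-sector eigenvector `φ` with eigenvalue `E` holds for `ψ`
itself (`re_expect_ge_of_forall_szSector`). This is Lieb's "S^z is conserved" bookkeeping (PRL 62 (1989) 1201,
proof of Thm 1), nothing more.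

§2 GENERIC EDGES (`4 × 4`, `t = 1`, `t' = 0`, `U = 8`, `N = 14`): `re_expect_ge/le_of_sectorObsCerts_four_N14_U8`
(any sector-preserving objective `X`, any value `q`; energy hypothesis BY NAME `torusUpper_mbbootE2_4x4_U8_N14`,
INHERITED E2 node) and their double-occupancy instances `doubleOcc_four_N14_U8_ge/le_of_sectorObsCerts`
(`q/16 ≤ d`, `d ≤ −q/16`) — the typed shape awaiting the `secrows1` D pair (no number here).

## References
* J. Wang et al., *Certifying ground-state properties of many-body systems*, PRX 14 (2024) 031006, §3
  eq. (obsopt). [cite: WangEtAl2024, §3 eq. (obsopt)]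
* E. H. Lieb, PRL 62 (1989) 1201, proof of Thm 1 (`S^z` sectors). [cite: LiebPRL1989, proof of Theorem 1]
* X. Han, *Quantum many-body bootstrap*, arXiv:2006.06002 (2020), §2 eq. (2)–(4). [cite: Han2020Bootstrap, §2 eq. (2)–(4)]
-/

noncomputable section

namespace Summit.HubbardSuperconductivity.HubbardLadder

open Matrix Literature.MathematicalPhysics.QuantumLattice Literature.Probability.LatticeModels
open Finset hiding expect
open FermionSpinMoment Bounds
open scoped ComplexOrder

/-! ## §1 The `S^z`-resolution glue (generic finite ordered lattice) -/

section SzGlue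

variable {Λ : Type*} [LinearOrder Λ] [Fintype Λ]

/-- `sectorProj a b` is self-adjoint: `⟨P v, w⟩ = ⟨v, P w⟩`. [cite: LiebPRL1989, proof of Theorem 1] -/
theorem star_sectorProj_dotProduct (a b : ℕ) (v w : Fock (Orb Λ)) :
    star (sectorProj a b v) ⬝ᵥ w = star v ⬝ᵥ sectorProj a b w := by
  simp only [dotProduct, Pi.star_apply, sectorProj_apply]
  exact Finset.sum_congr rfl fun s _ => by split_ifs <;> simp

/-- A sector component of an `N`-particle vector is an `N`-particle vector (`private`: the same statement is
landed in a route file of another topic, `ColourTheSpin.SgEndpoint.isNParticle_sectorProj_of_isNParticle`;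
kept local rather than importing that route module). [cite: LiebPRL1989, proof of Theorem 1] -/
private theorem isNParticle_sectorProj_of_isNParticle {N : ℕ} {ψ : Fock (Orb Λ)} (hN : IsNParticle N ψ) (a b : ℕ) :
    IsNParticle N (sectorProj a b ψ) := fun s hs => by
  rw [sectorProj_apply, hN s hs, ite_self]

/-- A sector component lies in the joint sector `(N, S^z = (a − b)/2)`. [cite: LiebPRL1989, proof of Theorem 1] -/
theorem sectorProj_mem_szSector_of_isNParticle {N : ℕ} {ψ : Fock (Orb Λ)} (hN : IsNParticle N ψ) (a b : ℕ) :
    sectorProj a b ψ ∈ (szSector N (((a : ℝ) - (b : ℝ)) / 2) : Submodule ℂ (Fock (Orb Λ))) := by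
  rw [mem_szSector_iff]
  refine ⟨isNParticle_sectorProj_of_isNParticle hN a b, ?_⟩
  rw [LiebThm1.spinZ_mulVec_of_isInSector (isInSector_sectorProj a b ψ)]
  congr 1
  push_cast
  ring

/-- **Sector decomposition of a matrix element.** If `X` preserves the `(N↑, N↓)` sectors then, for an
`N`-particle `ψ` with components `ψ_a = sectorProj a (N − a) ψ`,
`⟨ψ, X ψ⟩ = Σ_{a ≤ N} ⟨ψ_a, X ψ_a⟩`. [cite: LiebPRL1989, proof of Theorem 1] -/
theorem dotProduct_mulVec_eq_sum_sectorProj {X : Matrix (Finset (Orb Λ)) (Finset (Orb Λ)) ℂ}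
    (hX : PreservesSectors X) {N : ℕ} {ψ : Fock (Orb Λ)} (hN : IsNParticle N ψ) :
    star ψ ⬝ᵥ X *ᵥ ψ =
      ∑ a ∈ range (N + 1), star (sectorProj a (N - a) ψ) ⬝ᵥ X *ᵥ sectorProj a (N - a) ψ := by
  calc star ψ ⬝ᵥ X *ᵥ ψ = star ψ ⬝ᵥ X *ᵥ ∑ a ∈ range (N + 1), sectorProj a (N - a) ψ := by
        rw [sum_sectorProj_eq hN]
    _ = ∑ a ∈ range (N + 1), star ψ ⬝ᵥ X *ᵥ sectorProj a (N - a) ψ := by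
        rw [mulVec_sum, dotProduct_sum]
    _ = _ := Finset.sum_congr rfl fun a _ => by
        rw [star_sectorProj_dotProduct, ← hX.mulVec_sectorProj,
          sectorProj_eq_self (isInSector_sectorProj a (N - a) ψ)]

/-- `Σ_a ‖ψ_a‖² = ‖ψ‖²` for the sector components of an `N`-particle vector. [cite: LiebPRL1989, proof of Theorem 1] -/
theorem sum_star_sectorProj_dotProduct_self {N : ℕ} {ψ : Fock (Orb Λ)} (hN : IsNParticle N ψ) :
    ∑ a ∈ range (N + 1), star (sectorProj a (N - a) ψ) ⬝ᵥ sectorProj a (N - a) ψ = star ψ ⬝ᵥ ψ := by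
  have h1 : PreservesSectors (1 : Matrix (Finset (Orb Λ)) (Finset (Orb Λ)) ℂ) := by
    simpa using PreservesSectors.diagonal (Λ := Λ) fun _ => (1 : ℂ)
  have h := dotProduct_mulVec_eq_sum_sectorProj h1 hN
  simp only [one_mulVec] at h
  exact h.symm

/-- **The `S^z`-resolution glue.** Let `H` and `X` preserve the `(N↑, N↓)` sectors. If
`q ≤ Re ⟨φ, X φ⟩` for every unit vector `φ` of every joint sector `szSector N M` with `H φ = E φ`, then
`q ≤ Re ⟨ψ, X ψ⟩` for every unit `N`-particle `ψ` with `H ψ = E ψ` — `S^z`-eigen or not. (Decompose `ψ`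
into sector components; each is an `H`-eigenvector with the same `E`; cross terms vanish because `X`
preserves sectors; normalise each nonzero component.) [cite: LiebPRL1989, proof of Theorem 1] -/
theorem re_expect_ge_of_forall_szSector {H X : Matrix (Finset (Orb Λ)) (Finset (Orb Λ)) ℂ}
    (hH : PreservesSectors H) (hX : PreservesSectors X) {N : ℕ} {E : ℝ} {q : ℝ}
    (hq : ∀ (M : ℝ) (φ : Fock (Orb Λ)), φ ∈ (szSector N M : Submodule ℂ (Fock (Orb Λ))) →
      star φ ⬝ᵥ φ = 1 → H *ᵥ φ = (E : ℂ) • φ → q ≤ (star φ ⬝ᵥ X *ᵥ φ).re)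
    {ψ : Fock (Orb Λ)} (hN : IsNParticle N ψ) (hψ1 : star ψ ⬝ᵥ ψ = 1) (hHψ : H *ᵥ ψ = (E : ℂ) • ψ) :
    q ≤ (star ψ ⬝ᵥ X *ᵥ ψ).re := by
  -- the homogeneous bound on each sector component
  have hcomp : ∀ a : ℕ, q * (star (sectorProj a (N - a) ψ) ⬝ᵥ sectorProj a (N - a) ψ).re ≤
      (star (sectorProj a (N - a) ψ) ⬝ᵥ X *ᵥ sectorProj a (N - a) ψ).re := by
    intro a
    set φ := sectorProj a (N - a) ψ with hφ
    by_cases h0 : φ = 0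
    · simp [h0]
    have hpos : 0 < (star φ ⬝ᵥ φ).re := (Complex.pos_iff.mp (dotProduct_star_self_pos_iff.2 h0)).1
    obtain ⟨c, hc1, hc2⟩ := RayleighBottom.exists_smul_unit hpos
    have hφK := sectorProj_mem_szSector_of_isNParticle hN a (N - a)
    rw [← hφ] at hφK
    have hcK := Submodule.smul_mem _ c hφK
    have hHφ : H *ᵥ φ = (E : ℂ) • φ := by
      rw [hφ, hH.mulVec_sectorProj, hHψ, sectorProj_smul]
    have hHc : H *ᵥ (c • φ) = (E : ℂ) • (c • φ) := by rw [mulVec_smul, hHφ, smul_comm]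
    have h := hq _ (c • φ) hcK hc1 hHc
    have hcc : star c * c = ((‖c‖ ^ 2 : ℝ) : ℂ) := by
      rw [Complex.star_def, Complex.conj_mul', Complex.ofReal_pow]
    rw [star_smul, mulVec_smul, smul_dotProduct, dotProduct_smul, smul_smul, hcc, smul_eq_mul,
      Complex.re_ofReal_mul] at h
    calc q * (star φ ⬝ᵥ φ).re ≤ (‖c‖ ^ 2 * (star φ ⬝ᵥ X *ᵥ φ).re) * (star φ ⬝ᵥ φ).re :=
          mul_le_mul_of_nonneg_right h hpos.le
      _ = (star φ ⬝ᵥ X *ᵥ φ).re * (‖c‖ ^ 2 * (star φ ⬝ᵥ φ).re) := by ring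
      _ = (star φ ⬝ᵥ X *ᵥ φ).re := by rw [hc2, mul_one]
  -- sum over the sectors
  have hnorm : ∑ a ∈ range (N + 1), (star (sectorProj a (N - a) ψ) ⬝ᵥ sectorProj a (N - a) ψ).re = 1 := by
    rw [← Complex.re_sum, sum_star_sectorProj_dotProduct_self hN, hψ1, Complex.one_re]
  rw [dotProduct_mulVec_eq_sum_sectorProj hX hN, Complex.re_sum]
  calc q = ∑ a ∈ range (N + 1), q * (star (sectorProj a (N - a) ψ) ⬝ᵥ sectorProj a (N - a) ψ).re := by
        rw [← Finset.mul_sum, hnorm, mul_one]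
    _ ≤ _ := Finset.sum_le_sum fun a _ => hcomp a

/-! ### Sector preservation of the spin observables -/

omit [Fintype Λ] in
/-- A spin-raising matrix times a spin-lowering one preserves the sectors. [cite: LiebPRL1989, proof of Theorem 1] -/
theorem preservesSectors_raises_mul_lowers [Fintype Λ] {M M' : Matrix (Finset (Orb Λ)) (Finset (Orb Λ)) ℂ}
    (hM : RaisesSpin M) (hM' : LowersSpin M') : PreservesSectors (M * M') := by
  intro s s'' h
  rw [Matrix.mul_apply] at h
  obtain ⟨s', -, hs'⟩ := Finset.exists_ne_zero_of_sum_ne_zero h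
  have h1 := hM s s' (left_ne_zero_of_mul hs')
  have h2 := hM' s' s'' (right_ne_zero_of_mul hs')
  omega

omit [Fintype Λ] in
/-- A spin-lowering matrix times a spin-raising one preserves the sectors. [cite: LiebPRL1989, proof of Theorem 1] -/
theorem preservesSectors_lowers_mul_raises [Fintype Λ] {M M' : Matrix (Finset (Orb Λ)) (Finset (Orb Λ)) ℂ}
    (hM : LowersSpin M) (hM' : RaisesSpin M') : PreservesSectors (M * M') := by
  intro s s'' h
  rw [Matrix.mul_apply] at h
  obtain ⟨s', -, hs'⟩ := Finset.exists_ne_zero_of_sum_ne_zero h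
  have h1 := hM s s' (left_ne_zero_of_mul hs')
  have h2 := hM' s' s'' (right_ne_zero_of_mul hs')
  omega

/-- Differences of sector-preserving matrices preserve sectors (`private`: the same statement is landed in a
route file of another topic, `…HubbardSuperconductivity.Theorems.preservesSectors_sub`; kept local rather than
importing that route module). [cite: LiebPRL1989, proof of Theorem 1] -/
private theorem preservesSectors_of_sub {M M' : Matrix (Finset (Orb Λ)) (Finset (Orb Λ)) ℂ}
    (hM : PreservesSectors M) (hM' : PreservesSectors M') : PreservesSectors (M - M') := by
  rw [sub_eq_add_neg, ← neg_one_smul ℂ M']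
  exact hM.add (hM'.smul (-1))

/-- `S⁺_x` raises the spin sector. [cite: LiebPRL1989, eq. (2)] -/
theorem raisesSpin_fermionSpinPlus (x : Λ) : RaisesSpin (fermionSpinPlus x) :=
  LiebThm1.raisesSpin_flip x

/-- `S⁻_x` lowers the spin sector. [cite: LiebPRL1989, eq. (2)] -/
theorem lowersSpin_fermionSpinMinus (x : Λ) : LowersSpin (fermionSpinMinus x) := by
  rw [← conjTranspose_fermionSpinPlus]; exact (raisesSpin_fermionSpinPlus x).conjTranspose

/-- `S^z_x` preserves the sectors. [cite: LiebPRL1989, eq. (2)] -/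
theorem preservesSectors_fermionSpinZ (x : Λ) : PreservesSectors (fermionSpinZ x) :=
  (preservesSectors_of_sub (LiebThm1.preservesSectors_numberOp x 0) (LiebThm1.preservesSectors_numberOp x 1)).smul _

/-- **`𝐒_x·𝐒_y` preserves the `(N↑, N↓)` sectors** (it commutes with `N̂` and `S^z`). [cite: LiebPRL1989, proof of Theorem 1] -/
theorem preservesSectors_fermionSpinDot (x y : Λ) : PreservesSectors (fermionSpinDot x y) :=
  ((preservesSectors_raises_mul_lowers (raisesSpin_fermionSpinPlus x) (lowersSpin_fermionSpinMinus y)).add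
    (preservesSectors_lowers_mul_raises (lowersSpin_fermionSpinMinus x)
      (raisesSpin_fermionSpinPlus y))).smul _ |>.add
    ((preservesSectors_fermionSpinZ x).mul (preservesSectors_fermionSpinZ y))

/-- The staggered spin structure operator `𝓢_A` preserves the sectors. [cite: LiebPRL1989, Thm. 2] -/
theorem preservesSectors_stagSpinStructure (A : Finset Λ) : PreservesSectors (stagSpinStructure A) :=
  PreservesSectors.sum fun x _ => PreservesSectors.sum fun y _ => (preservesSectors_fermionSpinDot x y).smul _

/-- The double-occupancy operator `Σ_x n_{x↑} n_{x↓}` preserves the sectors. [cite: LiebPRL1989, eqs. (1)–(2)] -/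
theorem preservesSectors_doubleOcc :
    PreservesSectors (∑ x : Λ, numberOp x 0 * numberOp x 1 : Matrix (Finset (Orb Λ)) (Finset (Orb Λ)) ℂ) :=
  PreservesSectors.sum fun x _ => (LiebThm1.preservesSectors_numberOp x 0).mul (LiebThm1.preservesSectors_numberOp x 1)

end SzGlue

/-! ## §2 The `4 × 4`, `U = 8`, `N = 14`, `t' = 0` sector-certificate edges for every ground state -/

section FourByFour

/-- `𝓢 = stagStructureFour` preserves the sectors. [cite: LiebPRL1989, Thm. 2] -/
theorem preservesSectors_stagStructureFour : PreservesSectors stagStructureFour :=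
  preservesSectors_stagSpinStructure _

/-- **Generic LOWER edge (`4 × 4`, `t = 1`, `t' = 0`, `U = 8`, `N = 14`).** A family of sector-mode observable
certificates `TorusSectorObsCertTT' 4 1 0 8 14 M u₈ X q` (one inhabitant for every `M`; a certsdp/1 §9 file
without `S^z` ideal rows gives one), written with the energy-hypothesis constant
`u₈ = −815606355579/2³⁶` of the INHERITED node `torusUpper_mbbootE2_4x4_U8_N14`, for a sector-preserving
objective `X`, gives `q ≤ Re ⟨ψ, X ψ⟩` for EVERY normalised `14`-particle ground state `ψ` (§1 glue;
`hubbardTorusTT' 4 1 0 8 = hamiltonian (fermionTorusGraph 2 4) 1 8`). HONEST FRAMING: ladder R1–R4 with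
certified numbers; no claim on H/H₀. [cite: WangEtAl2024, §3 eq. (obsopt)] -/
theorem re_expect_ge_of_sectorObsCerts_four_N14_U8
    {X : Matrix (Finset (Orb (FermionTorus 2 4))) (Finset (Orb (FermionTorus 2 4))) ℂ} (hX : PreservesSectors X)
    {q : ℝ} (hC : ∀ M : ℝ, Nonempty (TorusSectorObsCertTT' 4 1 0 8 14 M ((-815606355579 : ℝ) / 2 ^ 36) X q))
    {ψ : Fock (Orb (FermionTorus 2 4))} (hψ : IsGroundState (hamiltonian (fermionTorusGraph 2 4) 1 8) 14 ψ)
    (hψ1 : star ψ ⬝ᵥ ψ = 1) (h₈ : torusUpper_mbbootE2_4x4_U8_N14) : q ≤ (expect X ψ).re := by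
  have hE : groundEnergy (hamiltonian (fermionTorusGraph 2 4) 1 8) 14 ≤ (-815606355579 : ℝ) / 2 ^ 36 :=
    groundEnergyAt_4x4_U8_N14_le_of_claim h₈
  refine re_expect_ge_of_forall_szSector (LiebThm1.preservesSectors_hamiltonian (fermionTorusGraph 2 4) 1 8) hX
    (fun M φ hφK hφ1 hHφ => ?_) hψ.1 hψ1 hψ.2.2
  exact (hC M).some.re_expect_ge_of_eigenvector hφK hφ1 (by rw [hubbardTorusTT'_zero]; exact hHφ) hE

/-- **Generic UPPER edge**: certificates for `−X` with value `q` give `Re ⟨ψ, X ψ⟩ ≤ −q` for every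
normalised `14`-particle ground state. HONEST FRAMING: ladder R1–R4 with certified numbers; no claim on H/H₀.
[cite: WangEtAl2024, §3 eq. (obsopt)] -/
theorem re_expect_le_of_sectorObsCerts_four_N14_U8
    {X : Matrix (Finset (Orb (FermionTorus 2 4))) (Finset (Orb (FermionTorus 2 4))) ℂ} (hX : PreservesSectors X)
    {q : ℝ} (hC : ∀ M : ℝ, Nonempty (TorusSectorObsCertTT' 4 1 0 8 14 M ((-815606355579 : ℝ) / 2 ^ 36) (-X) q))
    {ψ : Fock (Orb (FermionTorus 2 4))} (hψ : IsGroundState (hamiltonian (fermionTorusGraph 2 4) 1 8) 14 ψ)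
    (hψ1 : star ψ ⬝ᵥ ψ = 1) (h₈ : torusUpper_mbbootE2_4x4_U8_N14) : (expect X ψ).re ≤ -q := by
  have hX' : PreservesSectors (-X) := by simpa using hX.smul (-1)
  have h := re_expect_ge_of_sectorObsCerts_four_N14_U8 hX' hC hψ hψ1 h₈
  rw [expect, neg_mulVec, dotProduct_neg, Complex.neg_re] at h
  unfold expect
  linarith

/-- **Typed shape for the `secrows1` D pair (LOWER)**: certificates for `X = Σ_x n_{x↑} n_{x↓}` with value `q`
give the double-occupancy density floor `q/16 ≤ d` for every ground state (no number: the pair kit j105793 /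
j105797 is not harvested). HONEST FRAMING: ladder R1–R4 with certified numbers; no claim on H/H₀.
[cite: WangEtAl2024, §3 eq. (obsopt)] -/
theorem doubleOcc_four_N14_U8_ge_of_sectorObsCerts {q : ℝ}
    (hC : ∀ M : ℝ, Nonempty (TorusSectorObsCertTT' 4 1 0 8 14 M ((-815606355579 : ℝ) / 2 ^ 36)
      (∑ x : FermionTorus 2 4, numberOp x 0 * numberOp x 1) q))
    {ψ : Fock (Orb (FermionTorus 2 4))} (hψ : IsGroundState (hamiltonian (fermionTorusGraph 2 4) 1 8) 14 ψ)
    (hψ1 : star ψ ⬝ᵥ ψ = 1) (h₈ : torusUpper_mbbootE2_4x4_U8_N14) :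
    q / 16 ≤ (expect (∑ x : FermionTorus 2 4, numberOp x 0 * numberOp x 1) ψ).re / 16 :=
  div_le_div_of_nonneg_right (re_expect_ge_of_sectorObsCerts_four_N14_U8 preservesSectors_doubleOcc hC hψ hψ1 h₈)
    (by norm_num)

/-- **Typed shape for the `secrows1` D pair (UPPER)**: certificates for `X = −Σ_x n_{x↑} n_{x↓}` with value `q`
give `d ≤ −q/16`. HONEST FRAMING: ladder R1–R4 with certified numbers; no claim on H/H₀.
[cite: WangEtAl2024, §3 eq. (obsopt)] -/
theorem doubleOcc_four_N14_U8_le_of_sectorObsCerts {q : ℝ}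
    (hC : ∀ M : ℝ, Nonempty (TorusSectorObsCertTT' 4 1 0 8 14 M ((-815606355579 : ℝ) / 2 ^ 36)
      (-(∑ x : FermionTorus 2 4, numberOp x 0 * numberOp x 1)) q))
    {ψ : Fock (Orb (FermionTorus 2 4))} (hψ : IsGroundState (hamiltonian (fermionTorusGraph 2 4) 1 8) 14 ψ)
    (hψ1 : star ψ ⬝ᵥ ψ = 1) (h₈ : torusUpper_mbbootE2_4x4_U8_N14) :
    (expect (∑ x : FermionTorus 2 4, numberOp x 0 * numberOp x 1) ψ).re / 16 ≤ -q / 16 :=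
  div_le_div_of_nonneg_right (re_expect_le_of_sectorObsCerts_four_N14_U8 preservesSectors_doubleOcc hC hψ hψ1 h₈)
    (by norm_num)

end FourByFour

end Summit.HubbardSuperconductivity.HubbardLadder

end
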